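import Summits.QuantumFields.YangMills.Theorems.AllWindowsColdBoxBoxHighLineK4PrimeRowSum
import Summits.QuantumFields.YangMills.Theorems.AllWindowsColdBoxBoxHighLineK3PrimeRowQuad
import Summits.QuantumFields.YangMills.Theorems.AllWindowsColdBoxBoxHighLineK3PrimeRowE2CutSet

/-!
# U5 K3′ — the rows of the hK3 ROW SUM that are already BY NAME: E1-ghost, E1-Haar (quadratic vertices) and E2 (odd exact row), in the per-row `hKk` currency
# (planner ym-idea-2 g18 routing 2026-08-30T01:02:42Z «hK3 row-sum → fcl-p3 g27»; interface of record = w2 g33's `hK3` of ✓p753567; LINE-20 U5 ⟨stmt-QuantumFields-24336⟩)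

Free-hands helper of the κ-lineage (ym-line-fcl-p3 g27); companion of `…K3PrimeRowSum` (the row sum itself).  Pattern = w4 g30's ✓`K4RowSum.rowBound_R1` (`…K4PrimeRowSum`):
a landed row `|TERM| ≤ β⁻¹^3·C′·(1+log H)⁵·(1 + √τ·Hᵏ)` on every measurable `D ⊆ smallField H s` with `E₀[1−1_D] ≤ τ ≤ 1/2` becomes, with `τ := β⁻¹` (`q := 1`),
`K β H := C′·(1+log H)⁵·(1 + √(β⁻¹)·Hᵏ)/β³` and the budget `β²H⁸·K → 0` by ✓`AssemblyBudget.budget_monomial` (rows `8θ < 1` and `(8+k)θ < 3/2`, strict for every `θ < 1/10`):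

* `K3RowSum.rowBound_of_quadSize` (generic, `k = 4`), ★`K3RowSum.rowBound_E1_ghostM`, ★`K3RowSum.rowBound_E1_haar` — from w5 g24's ✓`…K3PrimeRowQuad`
  (`GaussRestrict.abs_tiltCum3_muSet_linCurvSq_linCurvSq_ghostM_le` / `…_quadVal_smul_one_le`, over fcl-p3's K3′(a) ✓p753741);
* ★`K3RowSum.rowBound_E2` (`k = 2`, factor `2·B₀·B`) — from w5 g24's ✓`EdgeChartGaussian.abs_tiltCum3_muSet_rowE2_le` (p755159), quantified over the record tensors in the
  prefix shape of the row sum (the record hypotheses are not needed for this row);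
* `K3RowSum.exists_bound_quadVal_smallField` — `quadVal M` is bounded on every small-field box (✓`TiltSup.abs_quadVal_le`, ✓`TiltSup.sum_norm_sq_le`).

No definitions; tree only; standard axioms.  HONEST LABEL: helper-grade U5 prep (three rows of hK3 by name; hK3 itself is NOT proved); U5, ⟨24336⟩, ⟨24004⟩ remain OPEN; route
AllWindowsColdBox is DRAFT; no crux, rung or summit is proved; **the Yang–Mills mass gap is NOT proved by this file; no summit is proved by a line.**
-/

set_option autoImplicit false

noncomputable section

open MeasureTheory

open Literature.Probability.LatticeModels (Site)
open Literature.MathematicalPhysics.QuantumLattice (ZdPlaquette plaquettesTouching)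
open Literature.MathematicalPhysics.QuantumFieldTheory.AxialGauge (boxEdges)
open Summit.QuantumFields.YangMills.Theorems.WeakCouplingRates (plaq12At)

namespace Summit.QuantumFields.YangMills.Theorems.AllWindowsColdBoxBoxHighLine

namespace K3RowSum

open AssemblyBudget ErrorBudget

/-- The per-row `hKk` currency of a quadratic-vertex exact row with the K3′(a) size `β⁻¹^3·C′·(1+log H)⁵·(1 + √τ·H⁴)` (w5 g24's uniform form of fcl-p3's ✓p753741):
`q := 1`, `K β H := C′·(1+log H)⁵·(1 + √(β⁻¹)·H⁴)/β³`; budgets `H⁸L⁵β⁻¹` (`8θ < 1`) and `H¹²L⁵β^{−3/2}` (`12θ < 3/2`). -/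
theorem rowBound_of_quadSize {θ : ℝ} (hθ : 0 < θ) (hθ' : θ < 1 / 10) {C' : ℝ} {V : (H : ℕ) → (LandauFree H → E3) → ℝ}
    (hV : ∀ H : ℕ, 1 ≤ H → ∀ β : ℝ, 0 < β → ∀ x y : Site 4, ∀ μ₁ ν₁ μ₂ ν₂ : Fin 4, ∀ s : ℝ, 0 ≤ s → ∀ D : Set (LandauFree H → E3), MeasurableSet D →
      D ⊆ smallField H s → ∀ τ : ℝ, gaussAvg β H (fun a => 1 - D.indicator (fun _ => (1 : ℝ)) a) ≤ τ → τ ≤ 1 / 2 →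
      |Tilt.tiltCum3 ((((volume : Measure (LandauFree H → E3)).restrict D).withDensity fun a => ENNReal.ofReal (gaussWeight β H a)))
          (V H) 0 (linCurvSq H (x, μ₁, ν₁)) (linCurvSq H (y, μ₂, ν₂))| ≤ β⁻¹ ^ 3 * (C' * (1 + Real.log H) ^ 5 * (1 + Real.sqrt τ * (H : ℝ) ^ 4))) :
    ∃ q : ℝ, ∃ K : ℝ → ℕ → ℝ,
      (∃ β₀ : ℝ, 1 ≤ β₀ ∧ ∀ β : ℝ, β₀ ≤ β → ∀ H : ℕ, 1 ≤ H → β ^ θ ≤ (H : ℝ) → (H : ℝ) ≤ β ^ θ + 1 →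
        ∀ D : Set (LandauFree H → E3), MeasurableSet D → D ⊆ smallField H (β ^ ((1 / 8 - θ / 4) - 1 / 2)) → (∀ a, -a ∈ D ↔ a ∈ D) →
        gaussAvg β H (fun a => 1 - D.indicator (fun _ => (1 : ℝ)) a) ≤ β ^ (-q) →
        gaussAvg β H (fun a => 1 - D.indicator (fun _ => (1 : ℝ)) a) ≤ 1 / 2 → (∀ a ∈ D, |tiltU β H a| ≤ 2) → ∀ x y : Site 4,
        |Tilt.tiltCum3 (((volume : Measure (LandauFree H → E3)).restrict D).withDensity fun a => ENNReal.ofReal (gaussWeight β H a))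
            (V H) 0 (linCurvSq H (plaq12At x)) (linCurvSq H (plaq12At y))| ≤ K β H) ∧
      (∀ ε : ℝ, 0 < ε → ∃ β₀ : ℝ, 1 ≤ β₀ ∧ ∀ β : ℝ, β₀ ≤ β → ∀ H : ℕ, 1 ≤ H → (H : ℝ) ≤ β ^ θ + 1 → β ^ 2 * (H : ℝ) ^ 8 * K β H ≤ ε) := by
  refine ⟨1, fun β H => C' * (1 + Real.log H) ^ 5 * (1 + Real.sqrt (β ^ (-(1 : ℝ))) * (H : ℝ) ^ 4) / β ^ 3, ⟨2, by norm_num, ?_⟩, ?_⟩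
  · intro β hβ H hH _ _ D hDm hDs _ hco _ _ x y
    have hβ0 : 0 < β := by linarith
    have hτ2 : β ^ (-(1 : ℝ)) ≤ 1 / 2 := by
      rw [Real.rpow_neg_one]
      have h := inv_anti₀ (by norm_num : (0 : ℝ) < 2) hβ
      norm_num at h ⊢
      exact h
    have h1 := hV H hH β hβ0 x y 1 2 1 2 _ (Real.rpow_nonneg hβ0.le _) D hDm hDs (β ^ (-(1 : ℝ))) hco hτ2
    have e : β⁻¹ ^ 3 * (C' * (1 + Real.log H) ^ 5 * (1 + Real.sqrt (β ^ (-(1 : ℝ))) * (H : ℝ) ^ 4)) =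
        C' * (1 + Real.log H) ^ 5 * (1 + Real.sqrt (β ^ (-(1 : ℝ))) * (H : ℝ) ^ 4) / β ^ 3 := by
      rw [inv_pow, div_eq_mul_inv, mul_comm]
    rw [e] at h1
    exact h1
  · intro ε hε
    have hε' : 0 < ε / 2 := half_pos hε
    obtain h₁ := budget_monomial (a := -1) (k := 8) (j := 0) (κ₃ := 0) hθ.le (by push_cast; linarith) hε' C' 5
    obtain h₂ := budget_monomial (a := -(3 / 2)) (k := 12) (j := 0) (κ₃ := 0) hθ.le (by push_cast; linarith) hε' C' 5
    obtain ⟨β₀, hβ₀, hall⟩ := exists_forall_and h₁ h₂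
    refine ⟨β₀, hβ₀, fun β hβ H hH hHu => ?_⟩
    obtain ⟨e₁, e₂⟩ := hall β hβ H
    replace e₁ := e₁ hH hHu
    replace e₂ := e₂ hH hHu
    simp only [pow_zero, mul_one] at e₁ e₂
    have hβ0 : 0 < β := by linarith
    have hsq : Real.sqrt (β ^ (-(1 : ℝ))) = β ^ (-(1 / 2 : ℝ)) := by
      rw [Real.sqrt_eq_rpow, ← Real.rpow_mul hβ0.le]; norm_num
    have hb3 : (β : ℝ) ^ 3 = β ^ (3 : ℝ) := by rw [← Real.rpow_natCast]; norm_num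
    have hb2 : (β : ℝ) ^ 2 = β ^ (2 : ℝ) := by rw [← Real.rpow_natCast]; norm_num
    have hm1 : β ^ (-1 : ℝ) = β ^ (2 : ℝ) * (β ^ (3 : ℝ))⁻¹ := by
      rw [← Real.rpow_neg hβ0.le, ← Real.rpow_add hβ0]; norm_num
    have hm2 : β ^ (-(3 / 2) : ℝ) = β ^ (2 : ℝ) * (β ^ (-(1 / 2 : ℝ)) * (β ^ (3 : ℝ))⁻¹) := by
      rw [← Real.rpow_neg hβ0.le, ← Real.rpow_add hβ0, ← Real.rpow_add hβ0]; norm_num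
    have hid : β ^ 2 * (H : ℝ) ^ 8 * (C' * (1 + Real.log H) ^ 5 * (1 + Real.sqrt (β ^ (-(1 : ℝ))) * (H : ℝ) ^ 4) / β ^ 3) =
        C' * (H : ℝ) ^ 8 * (1 + Real.log H) ^ 5 * β ^ (-1 : ℝ) +
          C' * (H : ℝ) ^ 12 * (1 + Real.log H) ^ 5 * β ^ (-(3 / 2) : ℝ) := by
      rw [hsq, hb3, hb2, div_eq_mul_inv, hm1, hm2]; ring
    rw [hid]
    linarith

/-- ★ **Row E1-ghost (quadratic ghost vertex `quadVal (ghostM H)`) in the per-row `hKk` currency, BY NAME** from w5 g24's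
✓`GaussRestrict.abs_tiltCum3_muSet_linCurvSq_linCurvSq_ghostM_le` (over fcl-p3's K3′(a) ✓p753741). -/
theorem rowBound_E1_ghostM : ∀ θ : ℝ, 0 < θ → θ < 1 / 10 → ∃ q : ℝ, ∃ K : ℝ → ℕ → ℝ,
      (∃ β₀ : ℝ, 1 ≤ β₀ ∧ ∀ β : ℝ, β₀ ≤ β → ∀ H : ℕ, 1 ≤ H → β ^ θ ≤ (H : ℝ) → (H : ℝ) ≤ β ^ θ + 1 →
        ∀ D : Set (LandauFree H → E3), MeasurableSet D → D ⊆ smallField H (β ^ ((1 / 8 - θ / 4) - 1 / 2)) → (∀ a, -a ∈ D ↔ a ∈ D) →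
        gaussAvg β H (fun a => 1 - D.indicator (fun _ => (1 : ℝ)) a) ≤ β ^ (-q) →
        gaussAvg β H (fun a => 1 - D.indicator (fun _ => (1 : ℝ)) a) ≤ 1 / 2 → (∀ a ∈ D, |tiltU β H a| ≤ 2) → ∀ x y : Site 4,
        |Tilt.tiltCum3 (((volume : Measure (LandauFree H → E3)).restrict D).withDensity fun a => ENNReal.ofReal (gaussWeight β H a))
            (quadVal (GhostFP.ghostM H)) 0 (linCurvSq H (plaq12At x)) (linCurvSq H (plaq12At y))| ≤ K β H) ∧
      (∀ ε : ℝ, 0 < ε → ∃ β₀ : ℝ, 1 ≤ β₀ ∧ ∀ β : ℝ, β₀ ≤ β → ∀ H : ℕ, 1 ≤ H → (H : ℝ) ≤ β ^ θ + 1 → β ^ 2 * (H : ℝ) ^ 8 * K β H ≤ ε) := by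
  intro θ hθ hθ'
  obtain ⟨C, -, h⟩ := GaussRestrict.abs_tiltCum3_muSet_linCurvSq_linCurvSq_ghostM_le
  exact rowBound_of_quadSize hθ hθ' (V := fun H => quadVal (GhostFP.ghostM H)) h

/-- ★ **Row E1-Haar (quadratic Haar vertex `quadVal (−(1/3)•1)`) in the per-row `hKk` currency, BY NAME** from w5 g24's
✓`GaussRestrict.abs_tiltCum3_muSet_linCurvSq_linCurvSq_quadVal_smul_one_le`. -/
theorem rowBound_E1_haar : ∀ θ : ℝ, 0 < θ → θ < 1 / 10 → ∃ q : ℝ, ∃ K : ℝ → ℕ → ℝ,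
      (∃ β₀ : ℝ, 1 ≤ β₀ ∧ ∀ β : ℝ, β₀ ≤ β → ∀ H : ℕ, 1 ≤ H → β ^ θ ≤ (H : ℝ) → (H : ℝ) ≤ β ^ θ + 1 →
        ∀ D : Set (LandauFree H → E3), MeasurableSet D → D ⊆ smallField H (β ^ ((1 / 8 - θ / 4) - 1 / 2)) → (∀ a, -a ∈ D ↔ a ∈ D) →
        gaussAvg β H (fun a => 1 - D.indicator (fun _ => (1 : ℝ)) a) ≤ β ^ (-q) →
        gaussAvg β H (fun a => 1 - D.indicator (fun _ => (1 : ℝ)) a) ≤ 1 / 2 → (∀ a ∈ D, |tiltU β H a| ≤ 2) → ∀ x y : Site 4,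
        |Tilt.tiltCum3 (((volume : Measure (LandauFree H → E3)).restrict D).withDensity fun a => ENNReal.ofReal (gaussWeight β H a))
            (quadVal ((-(1 / 3 : ℝ)) • (1 : Matrix (LandauFree H × Fin 3) (LandauFree H × Fin 3) ℝ))) 0
            (linCurvSq H (plaq12At x)) (linCurvSq H (plaq12At y))| ≤ K β H) ∧
      (∀ ε : ℝ, 0 < ε → ∃ β₀ : ℝ, 1 ≤ β₀ ∧ ∀ β : ℝ, β₀ ≤ β → ∀ H : ℕ, 1 ≤ H → (H : ℝ) ≤ β ^ θ + 1 → β ^ 2 * (H : ℝ) ^ 8 * K β H ≤ ε) := by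
  intro θ hθ hθ'
  obtain ⟨C, -, h⟩ := GaussRestrict.abs_tiltCum3_muSet_linCurvSq_linCurvSq_quadVal_smul_one_le
  refine rowBound_of_quadSize hθ hθ' (C' := C * |(-(1 / 3 : ℝ))|)
    (V := fun H => quadVal ((-(1 / 3 : ℝ)) • (1 : Matrix (LandauFree H × Fin 3) (LandauFree H × Fin 3) ℝ))) ?_
  intro H hH β hβ x y μ₁ ν₁ μ₂ ν₂ s hs D hDm hDs τ hτ hτ2
  exact h H hH β hβ (-(1 / 3 : ℝ)) x y μ₁ ν₁ μ₂ ν₂ s hs D hDm hDs τ hτ hτ2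

/-- ★ **Row E2 (the odd exact row `κ₃(Cx,Ly;P) + κ₃(Lx,Cy;P)`) in the per-row `hKk` currency, BY NAME** from w5 g24's ✓`EdgeChartGaussian.abs_tiltCum3_muSet_rowE2_le`
(p755159; E₀-exact core ✓`…K3PrimeRowE2` + fcl-p3's `μ_{D′}` transfer): for the generic bounded `Tc` (`|Tc| ≤ B`) and `T₀` (`|T₀| ≤ B₀`), `q := 1`,
`K β H := 2·C·B₀·B·(1+log H)⁵·(1 + √(β⁻¹)·H²)·β⁻¹^3`; budgets `H⁸L⁵β⁻¹` [`8θ − 1 < 0`] and `H¹⁰L⁵β^{−3/2}` [`10θ − 3/2 < 0`] — strict for every `θ < 1/10`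
(the record hypotheses on `Tc`, `T₀` are not needed for this row and are ignored). -/
theorem rowBound_E2 : ∀ θ : ℝ, 0 < θ → θ < 1 / 10 → ∀ B Cr : ℝ, ∀ Tc : ZdPlaquette 4 → Fin 4 → Fin 4 → Fin 4 → ℝ, (∀ p i j k, |Tc p i j k| ≤ B) →
      (∀ H : ℕ, 1 ≤ H → ∀ β : ℝ, 0 < β → ∀ s : ℝ, 0 ≤ s → ∀ a ∈ smallField H s,
        |cubicVertex β H a + β * ∑ p ∈ plaquettesTouching (boxEdges 4 (2 * H + 1)), tripleForm (Tc p) (plaqVar H p.1 p.2.1.1 p.2.1.2 a)| ≤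
          Cr * β * (H : ℝ) ^ 4 * s ^ 5) →
      ∀ B₀ C₀ : ℝ, ∀ T₀ : Fin 4 → Fin 4 → Fin 4 → ℝ, (∀ i j k, |T₀ i j k| ≤ B₀) →
      (∀ (H : ℕ) (x : Site 4) (t : ℝ) (a : LandauFree H → E3), 0 ≤ t → t ≤ 1 → (∀ i, ‖plaqVar H x 1 2 a i‖ ≤ t) →
        |chartPlaqCostOdd H x 1 2 a - tripleForm T₀ (plaqVar H x 1 2 a)| ≤ C₀ * t ^ 5) →
      ∃ q : ℝ, ∃ K : ℝ → ℕ → ℝ,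
      (∃ β₀ : ℝ, 1 ≤ β₀ ∧ ∀ β : ℝ, β₀ ≤ β → ∀ H : ℕ, 1 ≤ H → β ^ θ ≤ (H : ℝ) → (H : ℝ) ≤ β ^ θ + 1 →
        ∀ D : Set (LandauFree H → E3), MeasurableSet D → D ⊆ smallField H (β ^ ((1 / 8 - θ / 4) - 1 / 2)) → (∀ a, -a ∈ D ↔ a ∈ D) →
        gaussAvg β H (fun a => 1 - D.indicator (fun _ => (1 : ℝ)) a) ≤ β ^ (-q) →
        gaussAvg β H (fun a => 1 - D.indicator (fun _ => (1 : ℝ)) a) ≤ 1 / 2 → (∀ a ∈ D, |tiltU β H a| ≤ 2) → ∀ x y : Site 4,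
        let μD : Measure (LandauFree H → E3) := ((volume : Measure (LandauFree H → E3)).restrict D).withDensity fun a => ENNReal.ofReal (gaussWeight β H a)
        let P : (LandauFree H → E3) → ℝ := fun a => β * ∑ p ∈ plaquettesTouching (boxEdges 4 (2 * H + 1)), tripleForm (Tc p) (plaqVar H p.1 p.2.1.1 p.2.1.2 a)
        |Tilt.tiltCum3 μD P 0 (fun a => tripleForm T₀ (plaqVar H x 1 2 a)) (linCurvSq H (plaq12At y)) +
            Tilt.tiltCum3 μD P 0 (linCurvSq H (plaq12At x)) (fun a => tripleForm T₀ (plaqVar H y 1 2 a))| ≤ K β H) ∧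
      (∀ ε : ℝ, 0 < ε → ∃ β₀ : ℝ, 1 ≤ β₀ ∧ ∀ β : ℝ, β₀ ≤ β → ∀ H : ℕ, 1 ≤ H → (H : ℝ) ≤ β ^ θ + 1 → β ^ 2 * (H : ℝ) ^ 8 * K β H ≤ ε) := by
  intro θ hθ hθ' B Cr Tc hTc _ B₀ C₀ T₀ hT₀ _
  obtain ⟨C, -, hE2⟩ := EdgeChartGaussian.abs_tiltCum3_muSet_rowE2_le
  refine ⟨1, fun β H => 2 * (C * B₀ * B * (1 + Real.log H) ^ 5 * (1 + Real.sqrt (β ^ (-(1 : ℝ))) * (H : ℝ) ^ 2) * β⁻¹ ^ 3), ⟨2, by norm_num, ?_⟩, ?_⟩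
  · intro β hβ H hH _ _ D hDm hDs _ hco _ _ x y
    have hβ0 : 0 < β := by linarith
    have hτ2 : β ^ (-(1 : ℝ)) ≤ 1 / 2 := by
      rw [Real.rpow_neg_one]
      have h := inv_anti₀ (by norm_num : (0 : ℝ) < 2) hβ
      norm_num at h ⊢
      exact h
    exact hE2 H hH β hβ0 B₀ B (fun _ => T₀) (fun _ => hT₀) Tc hTc _ (Real.rpow_nonneg hβ0.le _) D hDm hDs (β ^ (-(1 : ℝ))) hco hτ2 x y
  · intro ε hε
    have hε' : 0 < ε / 2 := half_pos hε
    obtain h₁ := budget_monomial (a := -1) (k := 8) (j := 0) (κ₃ := 0) hθ.le (by push_cast; linarith) hε' (2 * C * B₀ * B) 5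
    obtain h₂ := budget_monomial (a := -(3 / 2)) (k := 10) (j := 0) (κ₃ := 0) hθ.le (by push_cast; linarith) hε' (2 * C * B₀ * B) 5
    obtain ⟨β₀, hβ₀, hall⟩ := exists_forall_and h₁ h₂
    refine ⟨β₀, hβ₀, fun β hβ H hH hHu => ?_⟩
    obtain ⟨e₁, e₂⟩ := hall β hβ H
    replace e₁ := e₁ hH hHu
    replace e₂ := e₂ hH hHu
    simp only [pow_zero, mul_one] at e₁ e₂
    have hβ0 : 0 < β := by linarith
    have hsq : Real.sqrt (β ^ (-(1 : ℝ))) = β ^ (-(1 / 2 : ℝ)) := by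
      rw [Real.sqrt_eq_rpow, ← Real.rpow_mul hβ0.le]; norm_num
    have hb3 : (β : ℝ)⁻¹ ^ 3 = (β ^ (3 : ℝ))⁻¹ := by rw [inv_pow, ← Real.rpow_natCast]; norm_num
    have hb2 : (β : ℝ) ^ 2 = β ^ (2 : ℝ) := by rw [← Real.rpow_natCast]; norm_num
    have hm1 : β ^ (-1 : ℝ) = β ^ (2 : ℝ) * (β ^ (3 : ℝ))⁻¹ := by
      rw [← Real.rpow_neg hβ0.le, ← Real.rpow_add hβ0]; norm_num
    have hm2 : β ^ (-(3 / 2) : ℝ) = β ^ (2 : ℝ) * (β ^ (-(1 / 2 : ℝ)) * (β ^ (3 : ℝ))⁻¹) := by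
      rw [← Real.rpow_neg hβ0.le, ← Real.rpow_add hβ0, ← Real.rpow_add hβ0]; norm_num
    have hid : β ^ 2 * (H : ℝ) ^ 8 * (2 * (C * B₀ * B * (1 + Real.log H) ^ 5 * (1 + Real.sqrt (β ^ (-(1 : ℝ))) * (H : ℝ) ^ 2) * β⁻¹ ^ 3)) =
        2 * C * B₀ * B * (H : ℝ) ^ 8 * (1 + Real.log H) ^ 5 * β ^ (-1 : ℝ) +
          2 * C * B₀ * B * (H : ℝ) ^ 10 * (1 + Real.log H) ^ 5 * β ^ (-(3 / 2) : ℝ) := by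
      rw [hsq, hb3, hb2, hm1, hm2]; ring
    rw [hid]
    linarith

/-- A bound for `quadVal M` on a small-field box (any matrix): `|quadVal M a| ≤ √(ΣM²)·|LandauFree H|·s²`. -/
theorem exists_bound_quadVal_smallField (H : ℕ) (M : Matrix (LandauFree H × Fin 3) (LandauFree H × Fin 3) ℝ) (s : ℝ) :
    ∃ BV : ℝ, ∀ a ∈ smallField H s, |quadVal M a| ≤ BV :=
  ⟨Real.sqrt (∑ i, ∑ j, M i j ^ 2) * (Fintype.card (LandauFree H) * s ^ 2), fun a ha =>
    (TiltSup.abs_quadVal_le M a).trans (mul_le_mul_of_nonneg_left (TiltSup.sum_norm_sq_le ha) (Real.sqrt_nonneg _))⟩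

end K3RowSum

end Summit.QuantumFields.YangMills.Theorems.AllWindowsColdBoxBoxHighLine

end
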